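import Summits.HubbardSuperconductivity.HubbardLadder.PairOperatorBinnedBound
import Summits.HubbardSuperconductivity.HubbardLadder.DWaveFormFactorSumUniform
import Summits.HubbardSuperconductivity.HubbardLadder.PairFieldCeilingUniform
import HarnessLib

/-!
# A kinematic ceiling for the `d`-wave pair field: `limsup_L L⁻⁴ ⟨Δ_d†Δ_d⟩ ≤ 128/π⁴`

pub-hubbard r3 — rung 0′ of the R4 ceiling ladder (R4-MEMO §9.10). HONEST FRAMING: ladder R1–R4
with certified numbers; no claim on H/H₀. NEW cell-side mathematics (not a published result), staged
by the r3 planner seat for a prover/librarian seat. Part 4 (last) of the rung-0′ files (imports `PairOperatorBinnedBound`,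
`DWaveFormFactorSumUniform`, and the landed `PairFieldCeilingUniform` for the ladder's currency).

**Explicit finite-volume ceilings**, every state `ψ` of the fermionic torus `(ℤ/Lℤ)²` (any filling,
any Hamiltonian — the bound is kinematic):
* odd `L`: `L⁻⁴ Re⟨ψ, Δ_d†Δ_d ψ⟩ ≤ 8 (4/π² + 19/(2L) + 6/L² + 1/L³)² ‖ψ‖²`
  (`pairFieldDensity_dWave_le_of_odd`);
* every `L ≥ 1`: `… ≤ 8 (4/π² + (4/π + 19/2)/L + 6/L² + 1/L³)² ‖ψ‖² ≤ 8 (4/π² + 18/L)² ‖ψ‖²`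
  (`re_expect_pairField_dWave_sq_div_le`, `…_le'`);
whose `L → ∞` limit is `8·16/π⁴ = 128/π⁴ ≈ 1.314`.

**In the ladder's currency** (`R3R4Props.pairFieldDensity`, `UniformPairFieldCeilingCert` of
`PairFieldCeilingUniform`): `pairFieldDensity_le_kinematic` (unit `ψ`: `p_d ≤ 8(4/π² + 18/L)²`),
`UniformPairFieldCeilingCert.exists_kinematic` (constant `128/π⁴ + g`, any `g > 0`, EVERY `H`, `N`),
**`limsup_dWaveOrderParamSq_le_kinematic`**: `limsup_k dWaveOrderParamSq ψ k ≤ 128/π⁴ (≤ 1.32)` for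
every admissible ground-state sequence of every family — below the channel-blind Yang rung 0
`2(1-δ²) = 63/32 ≈ 1.969` at `δ = 1/8` (`limsup_dWaveOrderParamSq_le_yang_eighth`). Typed obligation
`DWavePairFieldKinematicCeiling` + `_holds`.

Mechanism: `Δ_d†Δ_d = 8 B†B` with `B = Σ_k ĝ_d(k) b_k` a weighted sum of commuting hard-core bosons;
binning the levels of `ĝ_d` and the pseudo-spin block bound give `‖Bψ‖ ≲ ½ Φ_L ‖ψ‖`,
`Φ_L = Σ_k|ĝ_d(k)| ≤ 8L²/π² + 8L/π`. HONEST LABEL: kinematic; no numerics; not a booked rung.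
-/

namespace Summit.HubbardSuperconductivity.HubbardLadder

open Matrix Finset Filter Literature.Probability.LatticeModels
  Literature.MathematicalPhysics.QuantumLattice
open scoped ComplexOrder ComplexConjugate Topology

variable {L : ℕ} [NeZero L]

/-! ### Explicit ceilings -/

section explicit
variable (ψ : Fock (Orb (FermionTorus 2 L)))

/-- For odd `L`, every state `ψ` and every `ε > 0`:
`Re⟨ψ,Δ_d†Δ_dψ⟩ ≤ 8 (4L²/π² + (3/2)εL² + (4/ε+1)(2+ε))² ‖ψ‖²`. [folklore] -/
theorem re_expect_pairField_dWave_sq_le_of_odd (hodd : Odd L) (ε : ℝ) (hε : 0 < ε) :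
    (star ψ ⬝ᵥ (((pairField dWaveFormFactor L)ᴴ * pairField dWaveFormFactor L) *ᵥ ψ)).re ≤
      8 * (4 * (L : ℝ) ^ 2 / Real.pi ^ 2 + 3 / 2 * ε * (L : ℝ) ^ 2 + (4 / ε + 1) * (2 + ε)) ^ 2 *
        eucNorm ψ ^ 2 := by
  have h := re_expect_pairField_dWave_sq_le ψ ε hε
  have hΦ := sum_abs_dWaveGap_le (L := L) hodd
  have hΦ0 : 0 ≤ ∑ k : TorusSite 2 L, |dWaveGap k| := Finset.sum_nonneg fun k _ => abs_nonneg _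
  have hL : (0 : ℝ) ≤ (L : ℝ) ^ 2 := sq_nonneg _
  have hr : 0 ≤ 3 / 2 * ε * (L : ℝ) ^ 2 + (4 / ε + 1) * (2 + ε) := by positivity
  refine h.trans ?_
  have hbase : (∑ k : TorusSite 2 L, |dWaveGap k|) / 2 + 3 / 2 * ε * (L : ℝ) ^ 2 +
      (4 / ε + 1) * (2 + ε) ≤
      4 * (L : ℝ) ^ 2 / Real.pi ^ 2 + 3 / 2 * ε * (L : ℝ) ^ 2 + (4 / ε + 1) * (2 + ε) := by
    have : (∑ k : TorusSite 2 L, |dWaveGap k|) / 2 ≤ 4 * (L : ℝ) ^ 2 / Real.pi ^ 2 := by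
      rw [div_le_iff₀ (by norm_num : (0:ℝ) < 2)]
      calc ∑ k : TorusSite 2 L, |dWaveGap k| ≤ 8 * (L : ℝ) ^ 2 / Real.pi ^ 2 := hΦ
        _ = 4 * (L : ℝ) ^ 2 / Real.pi ^ 2 * 2 := by ring
    linarith
  have hb0 : 0 ≤ (∑ k : TorusSite 2 L, |dWaveGap k|) / 2 + 3 / 2 * ε * (L : ℝ) ^ 2 +
      (4 / ε + 1) * (2 + ε) := by positivity
  gcongr

/-- **Rung 0′, explicit form** (`ε = 1/L`): for odd `L` and every state `ψ`,
`L⁻⁴ Re⟨ψ,Δ_d†Δ_dψ⟩ ≤ 8 (4/π² + 19/(2L) + 6/L² + 1/L³)² ‖ψ‖²` (`→ 128/π⁴ ≈ 1.314`).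
Normalised states (`‖ψ‖ = 1`) and the `pairFieldDensity` normalisation of
`PairFieldYangCeiling` turn this into a bound on `P̄_d = L⁻⁴⟨Δ_d†Δ_d⟩`. [folklore] -/
theorem pairFieldDensity_dWave_le_of_odd (hodd : Odd L) :
    (star ψ ⬝ᵥ (((pairField dWaveFormFactor L)ᴴ * pairField dWaveFormFactor L) *ᵥ ψ)).re /
        (L : ℝ) ^ 4 ≤
      8 * (4 / Real.pi ^ 2 + 19 / (2 * L) + 6 / (L : ℝ) ^ 2 + 1 / (L : ℝ) ^ 3) ^ 2 *
        eucNorm ψ ^ 2 := by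
  have hL0 : (L : ℕ) ≠ 0 := NeZero.ne L
  have hLpos : (0 : ℝ) < L := by exact_mod_cast Nat.pos_of_ne_zero hL0
  have h := re_expect_pairField_dWave_sq_le_of_odd ψ hodd (1 / L) (by positivity)
  rw [div_le_iff₀ (by positivity)]
  refine h.trans (le_of_eq ?_)
  have hL' : (L : ℝ) ≠ 0 := hLpos.ne'
  field_simp
  ring


/-- For EVERY `L`, every state `ψ` and every `ε > 0`:
`Re⟨ψ,Δ_d†Δ_dψ⟩ ≤ 8 (4L²/π² + 4L/π + (3/2)εL² + (4/ε+1)(2+ε))² ‖ψ‖²`. [folklore] -/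
theorem re_expect_pairField_dWave_sq_le_uniform (ε : ℝ) (hε : 0 < ε) :
    (star ψ ⬝ᵥ (((pairField dWaveFormFactor L)ᴴ * pairField dWaveFormFactor L) *ᵥ ψ)).re ≤
      8 * (4 * (L : ℝ) ^ 2 / Real.pi ^ 2 + 4 * L / Real.pi + 3 / 2 * ε * (L : ℝ) ^ 2 +
        (4 / ε + 1) * (2 + ε)) ^ 2 * eucNorm ψ ^ 2 := by
  have h := re_expect_pairField_dWave_sq_le ψ ε hε
  have hΦ := sum_abs_dWaveGap_le_uniform (L := L)
  have hpi := Real.pi_pos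
  have hb0 : 0 ≤ (∑ k : TorusSite 2 L, |dWaveGap k|) / 2 + 3 / 2 * ε * (L : ℝ) ^ 2 +
      (4 / ε + 1) * (2 + ε) := by positivity
  refine h.trans ?_
  have hbase : (∑ k : TorusSite 2 L, |dWaveGap k|) / 2 + 3 / 2 * ε * (L : ℝ) ^ 2 +
      (4 / ε + 1) * (2 + ε) ≤
      4 * (L : ℝ) ^ 2 / Real.pi ^ 2 + 4 * L / Real.pi + 3 / 2 * ε * (L : ℝ) ^ 2 +
        (4 / ε + 1) * (2 + ε) := by
    have : (∑ k : TorusSite 2 L, |dWaveGap k|) / 2 ≤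
        4 * (L : ℝ) ^ 2 / Real.pi ^ 2 + 4 * L / Real.pi := by
      rw [div_le_iff₀ (by norm_num : (0:ℝ) < 2)]
      calc ∑ k : TorusSite 2 L, |dWaveGap k| ≤ 8 * (L : ℝ) ^ 2 / Real.pi ^ 2 + 8 * L / Real.pi := hΦ
        _ = (4 * (L : ℝ) ^ 2 / Real.pi ^ 2 + 4 * L / Real.pi) * 2 := by ring
    linarith
  gcongr

/-- **Rung 0′, explicit form for every `L`** (`ε = 1/L`):
`L⁻⁴ Re⟨ψ,Δ_d†Δ_dψ⟩ ≤ 8 (4/π² + (4/π + 19/2)/L + 6/L² + 1/L³)² ‖ψ‖²` (`→ 128/π⁴ ≈ 1.314`). [folklore] -/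
theorem re_expect_pairField_dWave_sq_div_le :
    (star ψ ⬝ᵥ (((pairField dWaveFormFactor L)ᴴ * pairField dWaveFormFactor L) *ᵥ ψ)).re /
        (L : ℝ) ^ 4 ≤
      8 * (4 / Real.pi ^ 2 + (4 / Real.pi + 19 / 2) / L + 6 / (L : ℝ) ^ 2 + 1 / (L : ℝ) ^ 3) ^ 2 *
        eucNorm ψ ^ 2 := by
  have hL0 : (L : ℕ) ≠ 0 := NeZero.ne L
  have hLpos : (0 : ℝ) < L := by exact_mod_cast Nat.pos_of_ne_zero hL0
  have hpi := Real.pi_pos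
  have h := re_expect_pairField_dWave_sq_le_uniform ψ (1 / L) (by positivity)
  rw [div_le_iff₀ (by positivity)]
  refine h.trans (le_of_eq ?_)
  have hL' : (L : ℝ) ≠ 0 := hLpos.ne'
  field_simp
  ring

/-- Crude but convenient: `L⁻⁴ Re⟨ψ,Δ_d†Δ_dψ⟩ ≤ 8 (4/π² + 18/L)² ‖ψ‖²` for every `L ≥ 1`
(`4/π + 19/2 ≤ 11` as `π > 3`, `6/L² + 1/L³ ≤ 7/L`). [folklore] -/
theorem re_expect_pairField_dWave_sq_div_le' :
    (star ψ ⬝ᵥ (((pairField dWaveFormFactor L)ᴴ * pairField dWaveFormFactor L) *ᵥ ψ)).re /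
        (L : ℝ) ^ 4 ≤ 8 * (4 / Real.pi ^ 2 + 18 / L) ^ 2 * eucNorm ψ ^ 2 := by
  have hL0 : (L : ℕ) ≠ 0 := NeZero.ne L
  have hL1 : (1 : ℝ) ≤ L := by exact_mod_cast Nat.one_le_iff_ne_zero.2 hL0
  have hLpos : (0 : ℝ) < L := by linarith
  have hpi3 : (3 : ℝ) < Real.pi := Real.pi_gt_three
  have hpi := Real.pi_pos
  refine (re_expect_pairField_dWave_sq_div_le ψ).trans ?_
  have hn : 0 ≤ eucNorm ψ ^ 2 := sq_nonneg _
  have hA0 : 0 ≤ 4 / Real.pi ^ 2 + (4 / Real.pi + 19 / 2) / L + 6 / (L : ℝ) ^ 2 + 1 / (L : ℝ) ^ 3 := by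
    positivity
  have hcoef : 4 / Real.pi + 19 / 2 ≤ 11 := by
    have : 4 / Real.pi ≤ 4 / 3 := div_le_div_of_nonneg_left (by norm_num) (by norm_num) hpi3.le
    linarith
  have h1 : (4 / Real.pi + 19 / 2) / L ≤ 11 / L := div_le_div_of_nonneg_right hcoef hLpos.le
  have h2 : 6 / (L : ℝ) ^ 2 ≤ 6 / L :=
    div_le_div_of_nonneg_left (by norm_num) hLpos (by nlinarith)
  have h3 : 1 / (L : ℝ) ^ 3 ≤ 1 / L :=
    div_le_div_of_nonneg_left (by norm_num) hLpos (by nlinarith)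
  have hsum : 4 / Real.pi ^ 2 + (4 / Real.pi + 19 / 2) / L + 6 / (L : ℝ) ^ 2 + 1 / (L : ℝ) ^ 3 ≤
      4 / Real.pi ^ 2 + 18 / L := by
    have : 11 / (L : ℝ) + 6 / L + 1 / L = 18 / L := by ring
    linarith
  gcongr

end explicit

/-! ### In the ladder's currency: `pairFieldDensity`, ceiling certificates, `limsup ≤ 128/π⁴` -/

section ladder

open Literature.MathematicalPhysics.QuantumLattice.ThermodynamicLimit
open Literature.MathematicalPhysics.QuantumManyBody.StateRelaxation

/-- **Kinematic `d`-wave ceiling on the pair-field density**: for every `L ≥ 1` and every UNIT state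
`ψ`, `p_d(L; ψ) = L⁻⁴⟨ψ, Δ_d†Δ_d ψ⟩ ≤ 8 (4/π² + 18/L)²`. No Hamiltonian, filling or parity of `L`
enters. [folklore] -/
theorem pairFieldDensity_le_kinematic (L : ℕ) [NeZero L] (ψ : Fock (Orb (FermionTorus 2 L)))
    (hψ : star ψ ⬝ᵥ ψ = 1) : pairFieldDensity L ψ ≤ 8 * (4 / Real.pi ^ 2 + 18 / L) ^ 2 := by
  obtain ⟨L', rfl⟩ : ∃ L', L = L' + 1 := ⟨L - 1, by have := NeZero.ne L; omega⟩
  rw [pairFieldDensity_succ]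
  have h := re_expect_pairField_dWave_sq_div_le' (L := L' + 1) ψ
  have hn : eucNorm ψ ^ 2 = 1 := by rw [eucNorm_sq, hψ]; simp
  rw [hn, mul_one] at h
  exact h

namespace UniformPairFieldCeilingCert

/-- **Rung 0′ of the ceiling format, certificate-free and `d`-wave specific**: for EVERY Hamiltonian
family `H`, EVERY particle-number map `N` and every `g > 0`, the kinematic bound is a uniform ceiling
certificate with constant `128/π⁴ + g` (the `O(1/L)` tail is absorbed from `L₀(g) > 2736/g` on).
[folklore] -/
theorem exists_kinematic (H : TorusHamiltonianFamily) (N : ℕ → ℕ) {g : ℝ} (hg : 0 < g) :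
    ∃ cert : UniformPairFieldCeilingCert H N, cert.ε = 128 / Real.pi ^ 4 + g := by
  obtain ⟨L₀, hL₀⟩ := exists_nat_gt (2736 / g)
  refine ⟨⟨128 / Real.pi ^ 4 + g, max 1 L₀, fun L hL _hE ψ h1 _hgs => ?_⟩, rfl⟩
  have hL1 : 1 ≤ L := le_of_max_le_left hL
  have hLL₀ : L₀ ≤ L := le_of_max_le_right hL
  haveI : NeZero L := ⟨by omega⟩
  refine (pairFieldDensity_le_kinematic L ψ h1).trans ?_
  have hpi3 : (3 : ℝ) < Real.pi := Real.pi_gt_three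
  have hpi := Real.pi_pos
  have hL1' : (1 : ℝ) ≤ L := by exact_mod_cast hL1
  have hLpos : (0 : ℝ) < L := by linarith
  have hA : 4 / Real.pi ^ 2 ≤ 1 / 2 := by
    rw [div_le_div_iff₀ (by positivity) (by norm_num)]
    nlinarith
  have hLg : 2736 / g < (L : ℝ) := hL₀.trans_le (by exact_mod_cast hLL₀)
  have htail : 288 * (4 / Real.pi ^ 2) / L + 2592 / (L : ℝ) ^ 2 ≤ g := by
    have h1' : 2592 / (L : ℝ) ^ 2 ≤ 2592 / L :=
      div_le_div_of_nonneg_left (by norm_num) hLpos (by nlinarith)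
    have h2' : 288 * (4 / Real.pi ^ 2) / L ≤ 144 / L :=
      div_le_div_of_nonneg_right (by linarith) hLpos.le
    have h3' : (2736 : ℝ) / L < g := by
      rw [div_lt_iff₀ hLpos]
      rw [div_lt_iff₀ hg] at hLg
      linarith
    have : 144 / (L : ℝ) + 2592 / L = 2736 / L := by ring
    linarith
  have expand : 8 * (4 / Real.pi ^ 2 + 18 / L) ^ 2 =
      128 / Real.pi ^ 4 + (288 * (4 / Real.pi ^ 2) / L + 2592 / (L : ℝ) ^ 2) := by
    field_simp
    ring
  rw [expand]
  linarith

end UniformPairFieldCeilingCert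

/-- **The kinematic `d`-wave ceiling on the order parameter (any Hamiltonian, rung 0′)**: for every
family `H`, every `N` and every admissible sequence of unit sector ground states,
`limsup_k dWaveOrderParamSq ψ k ≤ 128/π⁴ ≈ 1.314`. Compare rung 0 (`…_le_yang`, channel-blind):
`2(1 − δ²)`, `= 63/32 ≈ 1.969` at `δ = 1/8`. HONEST LABEL: kinematic (hard-core-boson algebra of the
pair modes + the `d`-wave form factor only); the physical order parameter is ~10⁻³; a certificate-based
`R4CeilingBlockCert` is informative only if its `E < 128/π⁴`. [folklore] -/
theorem limsup_dWaveOrderParamSq_le_kinematic (H : TorusHamiltonianFamily) (N : ℕ → ℕ)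
    (ψ : ∀ L, Fock (Orb (FermionTorus 2 L)))
    (hψ : ∀ L, Even L → star (ψ L) ⬝ᵥ ψ L = 1 ∧ IsGroundStateInSector (H L) (N L) 0 (ψ L)) :
    limsup (dWaveOrderParamSq ψ) atTop ≤ 128 / Real.pi ^ 4 := by
  refine le_of_forall_pos_le_add fun g hg => ?_
  obtain ⟨cert, hε⟩ := UniformPairFieldCeilingCert.exists_kinematic H N hg
  exact hε ▸ cert.limsup_dWaveOrderParamSq_le ψ hψ

/-- Numerical form: `limsup_k dWaveOrderParamSq ψ k ≤ 1.32` (`128/π⁴ < 128/3.14⁴ < 1.32 < 63/32`).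
[folklore] -/
theorem limsup_dWaveOrderParamSq_le_kinematic_num (H : TorusHamiltonianFamily) (N : ℕ → ℕ)
    (ψ : ∀ L, Fock (Orb (FermionTorus 2 L)))
    (hψ : ∀ L, Even L → star (ψ L) ⬝ᵥ ψ L = 1 ∧ IsGroundStateInSector (H L) (N L) 0 (ψ L)) :
    limsup (dWaveOrderParamSq ψ) atTop ≤ 1.32 := by
  refine (limsup_dWaveOrderParamSq_le_kinematic H N ψ hψ).trans ?_
  have hpi : (3.14 : ℝ) < Real.pi := Real.pi_gt_d2
  have h4 : (3.14 : ℝ) ^ 4 < Real.pi ^ 4 := by gcongr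
  rw [div_le_iff₀ (by positivity)]
  nlinarith

/-! ### Typed obligation (the cell's house style: `@[conjecture] def` + `_holds`) -/

/-- **Typed obligation R4 rung 0′ — the kinematic `d`-wave ceiling.** For every torus Hamiltonian
family `H`, every particle-number map `N` and every admissible sequence `ψ` of unit ground states of
the sectors `(N L, S^z = 0)`, `limsup_k dWaveOrderParamSq ψ k ≤ 128/π⁴`. PROVED
(`dWavePairFieldKinematicCeiling_holds`); `H`-independent, certificate-free; not a booked ladder rung
until the lead names it. -/
@[conjecture] def DWavePairFieldKinematicCeiling : Prop :=
  ∀ (H : TorusHamiltonianFamily) (N : ℕ → ℕ) (ψ : ∀ L, Fock (Orb (FermionTorus 2 L))),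
    (∀ L, Even L → star (ψ L) ⬝ᵥ ψ L = 1 ∧ IsGroundStateInSector (H L) (N L) 0 (ψ L)) →
      limsup (dWaveOrderParamSq ψ) atTop ≤ 128 / Real.pi ^ 4

/-- **Proof of `DWavePairFieldKinematicCeiling`.** -/
theorem dWavePairFieldKinematicCeiling_holds : DWavePairFieldKinematicCeiling :=
  fun H N ψ hψ => limsup_dWaveOrderParamSq_le_kinematic H N ψ hψ

end ladder

end Summit.HubbardSuperconductivity.HubbardLadder
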